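import Summits.QuantumFields.BalabanUV.T4Continuum.Support.NE7SliceRepHessianFloor
import Summits.QuantumFields.BalabanUV.T4Continuum.Support.NE7SliceRepExists
import HarnessLib

/-!
# NE7HessianFloorModGauge — IN EVERY FIBRE OF THE CONSTRAINT DIFFERENTIAL, EVERY ELEMENT IS CORNER-TRIVIALLY GAUGE-EQUIVALENT TO ONE WHOSE FINE WILSON HESSIAN DOMINATES THE
# COARSE MAXWELL ENERGY OF THE DATUM, j- AND N-UNIFORMLY (`d = 4`, every `U(n)`, `L ≥ 2`): for every skew fine torus field `X` with `v = levelQ′ X`, there is a `𝔲(n)`-valued periodic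
# `μ` vanishing on `L^{j+1}·ℤ⁴` such that `X′ := X + ξ_μ` (`ξ_μ = skewPR (res (gaugeDir U μ))`, a direction in `ker levelQ′`) has `levelQ′ X′ = v` and
# `Σ_P ‖curl_{V₀} ṽ(P)‖²_{HS∕n} ≤ ((1+θ) + 2K·4C_P·n)·hess U X̃′ X̃′ + 2K·(2·liftMassC + 4C_P·liftCurlC)·Σ_b ‖ṽ_b‖²`, `K = (1+θ)·14·#planes·ε + (1+θ⁻¹)·36·eC²·ε²`
# (lineage `b2b-balaban-t4-ne7-p1`, gen 118, file G4; ROAD-G117 §4 (S1) — the HESSIAN HALF of the sliced curved lower bound, closed modulo the multiplier term)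

Cell `pub-balaban`, rung (B)+1 sub-cell t4, CRUX PROVER NE7 #1 (OWNER of row NE7), generation 118.  G2 ✓ `NE7SliceRepHessianFloor` (the floor ON the slice `R₀ṽ + T_♮(U)`) composed with
G3 ✓ `NE7SliceRepExists` (every fibre element reaches the slice by a corner-trivial gauge direction), read in the road's torus∕`levelQ′` currency (gen 117 F6's dictionary
✓ `chartDir_levelQ'_eq_dirIter`).  Together with row NE7b's ✓ `NE7BorderedHessianGaugeDegenerate.borderedForm_add_gaugeDir` (`B[X + ξ_μ] = B[X]` for the bordered form
`B = w·D²𝒜 − Dm(0)∘D²𝒢` minimised in ✓ `NE7MinActHessianHessForm.minAct_hessian_hessForm_allData`) this gives, for every fibre element `X` over `v`: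
`B[X] = w·hess(X̃′) − Dm(0)[D²𝒢(0)[X′,X′]]` with `w·hess(X̃′) ≥ w·((1+θ) + O(ε·C_P))⁻¹·(Σ_P nhs(curl_{V₀}ṽ) − O(ε·C_P)·‖v‖²)` — the (G1)+(G2) half of (G′) in final form; what remains of (G′)
is the MULTIPLIER term `Dm(0)[D²𝒢(0)[X′,X′]]` on a representative (row NE7b's (G3) reduces it to level masses; the scale-correct currency needs a hierarchically frame-free
representative — NE7b g162's (H′) — or intermediate-frame decay on `T_♮`; memo ROAD-G118 §3).
WHAT ([folklore]; 0 def, 0 sorry; `d = 4`): `chartDir_add_skewPR_resDir` (the chart reading of `X + ξ_μ` is `X̃ + gaugeDir U μ`), `levelQ'_eq_of_chartDir_eq` (torus fields with the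
same chart reading of `levelQ′` agree), and **`exists_cornerGauge_hess_floor`** (displayed above; the slice Poincaré constant `C_P` is the SHAPE hypothesis `hSP`, row NE3-R2's
✓ `classSlicePoincare_of_lines` discharges it on the class).
HONEST FRAMING (page 1): composition of landed kernel theorems about OUR objects; the multiplier term is NOT bounded here; nothing of Bałaban's asserted ([Balaban1985PropagatorsII] Thm 3.3,
[Balaban1985Averaging] (48) are CONTEXT); NOT (G′), NOT NE7 as a spine node, NOT NE3; spine 0∕9; finite T⁴ rung (B)+1 — NOT infinite volume, NOT mass gap, NOT BetaPertH, NOT Clay.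
-/

set_option autoImplicit false

open scoped BigOperators Matrix Matrix.Norms.L2Operator
open NormedSpace Finset

namespace Summit.QuantumFields.BalabanUV.T4Continuum.NE7HessianFloorModGauge

open Literature.MathematicalPhysics.QuantumFieldTheory.Balaban1983to89
open B7Prop1Explicit B7Prop2Explicit MatrixLog UnitaryModel
open T4AveragingDeficitWall (IsUnitaryCfg IsSkewDir SmallField Ad curl curlAt curlSq dirSq)
open T4AveragingDeficitWallBoundary (IsPeriodicCfg periodBox)
open AveragingDeficitPeriodicCounting (IsPeriodicDir)
open AveragingDeficitTorusChart (TDir chartDir resDir redN_boxVec isPeriodicDir_chartDir chartDir_id_resDir)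
open AveragingDeficitTwoLevelPrep (twoLevelSmall skewSub skewPR skewPF skewPF_of_mem prop1Radius)
open AveragingDeficitMultiLevelPrep (cavgIter tower levelQ' tower_ne_zero LevelSmall natCast_tower_succ)
open MatrixNorms (nhsNormSq nhsNormSq_nonneg)
open MinimalActionLevels (perWin)
open NE3HessForm (hess)
open NE3TangentCovariantTower (framePotW dirIter)
open NE3EnergyHessContTwoTerm (dirSq_nonneg)
open NE7RadIterUniform (radD)
open NE7StraightTowerCurlEnergy (eC mC)
open NE7FlatAverageCurlCommutation (isSkewDir_chartDir_id)
open NE7FrameCorrectedCurlEnergyTower (chartDir_levelQ'_eq_dirIter)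
open BlockAveragePushDirGauge (gaugeDir isPeriodicDir_gaugeDir)
open NE3LandauOrbit (gaugeDir_skew)
open NE3QbarIterCovLiftPrep (cruxC)
open NE3RightInverseSolveLetters (thetaLoc)
open NE3SlicePoincareShape (SlicePoincare)
open NE3FrameFreeSliceW (frameFreeBlockLandauW)
open NE3EnergyRateWSupOfSlicePoincare (tower_eq_mul_pow)
open NE7FrameFreeRightInverse (rightInvW0 framePotW_rightInvW0)
open NE7SliceRepHessianFloor (liftMassC liftCurlC dirSq_rightInvW0_class_le curlSq_rightInvW0_class_le coarse_curl_le_hess_of_mem_slice sliceRep_args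
  sq_mul_classRadius_eq)
open NE7SliceRepExists (exists_cornerGauge_sliceRep)

noncomputable section

variable {d : ℕ} {n : Type*} [Fintype n] [DecidableEq n]

/-! ## §1 Chart bookkeeping -/

omit [DecidableEq n] in
/-- **THE CHART READING OF `X + ξ_μ` IS `X̃ + gaugeDir U μ`**: for a skew `M`-periodic site field `G` (here `G = gaugeDir U μ`) and a torus field `X`,
`chartDir id M (X + skewPR M (res_M G)) = X̃ + G` pointwise. [folklore] -/
theorem chartDir_add_skewPR_resDir {M : ℕ} [NeZero M] (X : TDir d n M) {G : Site d → Fin d → Matrix n n ℂ} (hGs : IsSkewDir G)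
    (hGP : IsPeriodicDir G (M : ℤ)) (y : Site d) (ν : Fin d) :
    chartDir (ContinuousLinearMap.id ℝ (Matrix n n ℂ)) M (X + ((skewPR (d := d) (n := n) M (resDir M G) : ↥(skewSub d n M)) : TDir d n M)) y ν
      = chartDir (ContinuousLinearMap.id ℝ (Matrix n n ℂ)) M X y ν + G y ν := by
  have hmem : resDir M G ∈ skewSub d n M := fun r κ => hGs _ κ
  have hco : ((skewPR (d := d) (n := n) M (resDir M G) : ↥(skewSub d n M)) : TDir d n M) = resDir M G := by
    show skewPF M (resDir M G) = resDir M G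
    exact skewPF_of_mem hmem
  have hG := congrArg (fun f => f y ν) (chartDir_id_resDir M hGP)
  rw [hco, ← hG]
  simp only [chartDir, ContinuousLinearMap.id_apply, Pi.add_apply]

omit [Fintype n] [DecidableEq n] in
/-- **TORUS FIELDS WITH THE SAME CHART READING AGREE** (insert `id`). [folklore] -/
theorem eq_of_chartDir_eq {N : ℕ} [NeZero N] {ψ ψ' : TDir d n N}
    (h : chartDir (ContinuousLinearMap.id ℝ (Matrix n n ℂ)) N ψ = chartDir (ContinuousLinearMap.id ℝ (Matrix n n ℂ)) N ψ') : ψ = ψ' := by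
  funext r κ
  have := congrArg (fun f => f (boxVec N r) κ) h
  simpa only [chartDir, ContinuousLinearMap.id_apply, redN_boxVec] using this

/-! ## §2 The Hessian floor modulo corner-trivial gauge directions (`d = 4`) -/

/-- **THE HESSIAN HALF OF THE SLICED CURVED LOWER BOUND, IN FINAL FORM** (`d = 4`, every `U(n)`, `L ≥ 2`, j- AND N-UNIFORM).  Class configuration `U` (unitary,
`(tower L N (j+1))`-periodic, `SmallField U (ε·L^{−2(j+1)})`); k-free ε-lines `hεD`, `hεT`, `hεM` (gen 117 F7), `ε ≤ 1`, `cruxC·ε < 1`, `thetaLoc·ε ≤ 1∕2`, `43584·ε ≤ 1∕2`; row NE3's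
slice Poincaré SHAPE `hSP` with constant `C_P ≥ 0` and the absorption line `28·#planes·ε·(4C_P·card n) ≤ 1`; `θ > 0`.  Then for every skew fine torus field `X` (`M = L·tower L N j`), with
`v := levelQ' L N j U X`, `ṽ := chartDir id N ↑v`, `V₀ := cavgIter L (j+1) U`, there is a `𝔲(n)`-valued `M`-periodic `μ` with `μ(L^{j+1}·w) = 0` such that `X′ := X + skewPR M (res_M (gaugeDir U μ))`
satisfies `levelQ' L N j U X′ = v` and
**`Σ_{P∈perWin N} nhsNormSq (curl V₀ ṽ P) ≤ ((1+θ) + 2K·(4C_P·card n))·hess U X̃′ X̃′ (perWin 4 (tower L N (j+1))) + 2K·(2·liftMassC 4 L + 4C_P·liftCurlC 4 L)·dirSq ṽ (periodBox N)`**,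
`K = (1+θ)·14·#planes·ε + (1+θ⁻¹)·36·eC²·ε²`, `X̃′ = chartDir id M ↑X′`. [cite: Balaban1985Averaging, (48) p.25; Balaban1985PropagatorsII, Thm 3.3 (3.46); Balaban1985Variational, (83) p.290] -/
theorem exists_cornerGauge_hess_floor [Nonempty n] {L N : ℕ} [NeZero L] [NeZero N] (hL : 2 ≤ L) (hN : 1 ≤ N) {ε : ℝ} (hε : 0 ≤ ε)
    (hεD : 4 * ε * radD 4 L * (((L : ℝ) ^ 2)⁻¹) ^ 2 ≤ 1) (hεT : twoLevelSmall 4 L * (2 * ε * ((L : ℝ) ^ 2)⁻¹) ≤ 1)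
    (hεM : 8 * (L : ℝ) * mC 4 L (Fintype.card n) * ε * ((L : ℝ) ^ 2)⁻¹ ≤ 1) (hε1 : ε ≤ 1) (hcrux : cruxC 4 L * ε < 1)
    (hθl2 : thetaLoc 4 L * ε ≤ 1 / 2) (hEl : 43584 * ε ≤ 1 / 2) (j : ℕ)
    {U : Site 4 → Fin 4 → (Matrix n n ℂ)ˣ} (hU : IsUnitaryCfg U) (hUP : IsPeriodicCfg U ((tower L N (j + 1) : ℕ) : ℤ))
    (hUx : SmallField U (ε * (((L : ℝ) ^ 2)⁻¹) ^ (j + 1)))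
    {CP : ℝ} (hCP : 0 ≤ CP) (hSP : SlicePoincare L (j + 1) U (frameFreeBlockLandauW (d := 4) (n := n) L N (j + 1) U) CP (periodBox (N * L ^ (j + 1))))
    (habs : 28 * (Fintype.card (T4AveragingDeficitWall.Plane 4) : ℝ) * ε * (4 * CP * Fintype.card n) ≤ 1) {θ : ℝ} (hθ : 0 < θ)
    (X : ↥(skewSub 4 n (L * tower L N j))) :
    ∃ mu : Site 4 → Matrix n n ℂ, (∀ y, mu y ∈ skewAdjoint (Matrix n n ℂ))
      ∧ (∀ (y : Site 4) (i : Fin 4), mu (y + ((L * tower L N j : ℕ) : ℤ) • e i) = mu y)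
      ∧ (∀ w : Site 4, mu (((L : ℤ) ^ (j + 1)) • w) = 0)
      ∧ levelQ' L N j U ((X + skewPR (d := 4) (n := n) (L * tower L N j) (resDir (L * tower L N j) (gaugeDir U mu)) : ↥(skewSub 4 n (L * tower L N j)))
            : TDir 4 n (L * tower L N j)) = levelQ' L N j U (X : TDir 4 n (L * tower L N j))
      ∧ ∑ P ∈ perWin 4 N, nhsNormSq
          (curl (cavgIter L (j + 1) U) (chartDir (ContinuousLinearMap.id ℝ (Matrix n n ℂ)) N ((levelQ' L N j U (X : TDir 4 n (L * tower L N j)) : ↥(skewSub 4 n N)) : TDir 4 n N)) P)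
        ≤ ((1 + θ) + 2 * ((1 + θ) * (14 * (Fintype.card (T4AveragingDeficitWall.Plane 4) : ℝ) * ε) + (1 + θ⁻¹) * (36 * eC 4 L (Fintype.card n) ^ 2 * ε ^ 2))
              * (4 * CP * Fintype.card n))
            * hess U (chartDir (ContinuousLinearMap.id ℝ (Matrix n n ℂ)) (L * tower L N j)
                  ((X + skewPR (d := 4) (n := n) (L * tower L N j) (resDir (L * tower L N j) (gaugeDir U mu)) : ↥(skewSub 4 n (L * tower L N j))) : TDir 4 n (L * tower L N j)))
                (chartDir (ContinuousLinearMap.id ℝ (Matrix n n ℂ)) (L * tower L N j)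
                  ((X + skewPR (d := 4) (n := n) (L * tower L N j) (resDir (L * tower L N j) (gaugeDir U mu)) : ↥(skewSub 4 n (L * tower L N j))) : TDir 4 n (L * tower L N j)))
                (perWin 4 (tower L N (j + 1)))
          + 2 * ((1 + θ) * (14 * (Fintype.card (T4AveragingDeficitWall.Plane 4) : ℝ) * ε) + (1 + θ⁻¹) * (36 * eC 4 L (Fintype.card n) ^ 2 * ε ^ 2))
              * ((2 * liftMassC 4 L + 4 * CP * liftCurlC 4 L)
                  * dirSq (chartDir (ContinuousLinearMap.id ℝ (Matrix n n ℂ)) N ((levelQ' L N j U (X : TDir 4 n (L * tower L N j)) : ↥(skewSub 4 n N)) : TDir 4 n N))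
                      (periodBox N)) := by
  have hL1 : 1 ≤ L := by omega
  have hLd : 2 ≤ L ^ 4 := le_trans hL (Nat.le_self_pow (by norm_num) L)
  obtain ⟨hx, hs, hcr, hE⟩ := sliceRep_args hL hε hεD hεT hcrux hEl j
  have hMx := sq_mul_classRadius_eq hL1 ε j
  have hθl2' : thetaLoc 4 L * (((L : ℝ) ^ (j + 1)) ^ 2 * (ε * (((L : ℝ) ^ 2)⁻¹) ^ (j + 1))) ≤ 1 / 2 := by rw [hMx]; exact hθl2
  have hε1' : ((L : ℝ) ^ (j + 1)) ^ 2 * (ε * (((L : ℝ) ^ 2)⁻¹) ^ (j + 1)) ≤ 1 := by rw [hMx]; exact hε1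
  have hUP' : IsPeriodicCfg U ((L : ℤ) * (tower L N j : ℕ)) := by rw [← natCast_tower_succ]; exact hUP
  -- the chart readings
  set Xt := chartDir (ContinuousLinearMap.id ℝ (Matrix n n ℂ)) (L * tower L N j) (X : TDir 4 n (L * tower L N j)) with hXt
  set vt := chartDir (ContinuousLinearMap.id ℝ (Matrix n n ℂ)) N ((levelQ' L N j U (X : TDir 4 n (L * tower L N j)) : ↥(skewSub 4 n N)) : TDir 4 n N) with hvt
  have hXts : IsSkewDir Xt := isSkewDir_chartDir_id X.2
  have hXtP : IsPeriodicDir Xt ((tower L N (j + 1) : ℕ) : ℤ) := isPeriodicDir_chartDir (ContinuousLinearMap.id ℝ (Matrix n n ℂ)) (L * tower L N j) (X : TDir 4 n (L * tower L N j))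
  have hvs : IsSkewDir vt := isSkewDir_chartDir_id (levelQ' L N j U (X : TDir 4 n (L * tower L N j))).2
  have hvP : IsPeriodicDir vt (N : ℤ) := isPeriodicDir_chartDir (ContinuousLinearMap.id ℝ (Matrix n n ℂ)) N _
  have hXφ : dirIter L (j + 1) U Xt = vt := (chartDir_levelQ'_eq_dirIter hL1 j hU hUP' hx hs hUx X.2).symm
  -- G3: the corner-trivial gauge into the slice
  obtain ⟨mu, hmus, hmuP, hmu0, hdir, hmem⟩ := exists_cornerGauge_sliceRep (N := N) hL hLd (by norm_num) j hU hUP hx hs hUx hcr hE hXts hXtP hvs hvP hXφ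
  have hmuP' : ∀ (y : Site 4) (i : Fin 4), mu (y + ((L * tower L N j : ℕ) : ℤ) • e i) = mu y := hmuP
  refine ⟨mu, hmus, hmuP', hmu0, ?_⟩
  -- the gauge direction and the chart reading of `X′`
  have hGs : IsSkewDir (gaugeDir U mu) := gaugeDir_skew hU hmus
  have hGP : IsPeriodicDir (gaugeDir U mu) ((L * tower L N j : ℕ) : ℤ) := isPeriodicDir_gaugeDir hUP hmuP
  set X' : ↥(skewSub 4 n (L * tower L N j)) := X + skewPR (d := 4) (n := n) (L * tower L N j) (resDir (L * tower L N j) (gaugeDir U mu)) with hX'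
  have hchart : chartDir (ContinuousLinearMap.id ℝ (Matrix n n ℂ)) (L * tower L N j) (X' : TDir 4 n (L * tower L N j)) = fun y ν => Xt y ν + gaugeDir U mu y ν := by
    funext y ν
    exact chartDir_add_skewPR_resDir (X : TDir 4 n (L * tower L N j)) hGs hGP y ν
  -- `levelQ' X′ = levelQ' X`
  have hq : levelQ' L N j U (X' : TDir 4 n (L * tower L N j)) = levelQ' L N j U (X : TDir 4 n (L * tower L N j)) := by
    apply Subtype.ext
    apply eq_of_chartDir_eq
    rw [chartDir_levelQ'_eq_dirIter hL1 j hU hUP' hx hs hUx X'.2, hchart, hdir, hvt]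
  refine ⟨hq, ?_⟩
  -- G2 on the slice, with the lift `R₀ ṽ`
  set R := rightInvW0 hL j hU hx hs hUx N hcr hE hvs with hR
  have hRff : ∀ z : Site 4, framePotW L (j + 1) U R z = 0 := fun z => framePotW_rightInvW0 hL j hU hx hs hUx N hcr hE hvs hUP ⟨0, by omega⟩ z
  have hRA0 := dirSq_rightInvW0_class_le hL j hU hx hs hUx N hcr hE hUP hθl2' hε1' hvs (by norm_num)
  have hRB0 := curlSq_rightInvW0_class_le hL j hU hx hs hUx N hcr hE hUP hθl2' hε1' hvs
  rw [← tower_eq_mul_pow] at hRA0 hRB0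
  set m := dirSq vt (periodBox (d := 4) N) with hm
  have hM0 : (0 : ℝ) < (L : ℝ) ^ (j + 1) := by
    have hL0 : (0 : ℝ) < L := by exact_mod_cast (show 0 < L by omega)
    positivity
  have e42 : ((L : ℝ) ^ (j + 1)) ^ 4 / ((L : ℝ) ^ (j + 1)) ^ 2 = ((L : ℝ) ^ (j + 1)) ^ 2 := by
    rw [div_eq_iff (by positivity)]; ring
  have e44 : ((L : ℝ) ^ (j + 1)) ^ 4 / ((L : ℝ) ^ (j + 1)) ^ 4 = 1 := div_self (by positivity)
  rw [e42] at hRA0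
  rw [e44, one_mul] at hRB0
  have hslice : (fun y ν => chartDir (ContinuousLinearMap.id ℝ (Matrix n n ℂ)) (L * tower L N j) (X' : TDir 4 n (L * tower L N j)) y ν - R y ν)
      ∈ frameFreeBlockLandauW (d := 4) (n := n) L N (j + 1) U := by
    rw [hchart]; exact hmem
  have h := coarse_curl_le_hess_of_mem_slice hL hN hε hεD hεT hεM j hU hUP hUx X'.2 hRff hCP hRA0 hRB0 hslice hSP habs hθ
  rw [hq] at h
  have hqq : ((L : ℝ)⁻¹) ^ (2 * (j + 1)) * ((L : ℝ) ^ (j + 1)) ^ 2 = 1 := by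
    rw [← NE7SliceRepHessianFloor.inv_pow_sq_eq, ← mul_pow, inv_mul_cancel₀ hM0.ne', one_pow]
  have e : 2 * ((L : ℝ)⁻¹) ^ (2 * (j + 1)) * (((L : ℝ) ^ (j + 1)) ^ 2 * liftMassC 4 L * m) + 4 * CP * (liftCurlC 4 L * m)
      = (2 * liftMassC 4 L + 4 * CP * liftCurlC 4 L) * m := by
    calc 2 * ((L : ℝ)⁻¹) ^ (2 * (j + 1)) * (((L : ℝ) ^ (j + 1)) ^ 2 * liftMassC 4 L * m) + 4 * CP * (liftCurlC 4 L * m)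
        = (2 * (((L : ℝ)⁻¹) ^ (2 * (j + 1)) * ((L : ℝ) ^ (j + 1)) ^ 2) * liftMassC 4 L + 4 * CP * liftCurlC 4 L) * m := by ring
      _ = _ := by rw [hqq, mul_one]
  rw [e] at h
  exact h

end

end Summit.QuantumFields.BalabanUV.T4Continuum.NE7HessianFloorModGauge
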